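import Literature.Probability.RandomPlanarGeometry.SAWBridgeTwoStepRate
import Literature.Probability.RandomPlanarGeometry.SAWBridgeRatioRateZ2
import Literature.Probability.RandomPlanarGeometry.SAWBridgeRatioRate
import Literature.Probability.RandomPlanarGeometry.SAWBridgeRenewalEquation
import Literature.Probability.RandomPlanarGeometry.SAWBridgeRenewalLimit
import Literature.Probability.RandomPlanarGeometry.SAWBridgeDivergence
import Literature.Probability.RandomPlanarGeometry.SAWKestenRelation
import Mathlib.Analysis.SpecialFunctions.Pow.Real
import Mathlib.Analysis.SpecialFunctions.Pow.Asymptotics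
import HarnessLib

/-!
# Kesten's infinite-bridge measure with a rate, I: the first-break-point law of a uniform bridge

Topic `Literature/Probability/RandomPlanarGeometry` (continues `SAWBridgeTwoStepRate.lean`,
`SAWBridgeRatioRateZ2.lean`, `SAWBridgeRenewalEquation.lean`).

Source: N. Madras, G. Slade, *The Self-Avoiding Walk* (1993), §8.3 "The infinite bridge", book
pp. 272–275 (held text `book:madras1993-self-avoiding-walk` p0284–p0287): Theorem 8.3.1 (p0285:L35–37)
"Let `ω` be an `m`-step self-avoiding walk. Then the limit (8.3.3) exists", proved via (8.3.5)–(8.3.13)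
by Fatou / lim sup from Theorem 7.3.4 (d) (`b_{N+1}/b_N → μ`) and the renewal structure (4.2.2); §8.5
Notes (book p. 279, p0291:L8): "Section 8.3. The results of this section are new." — EXISTENCE ONLY, no
rate anywhere in print.

## What is new in this file (not in print)

The load-bearing quantitative input behind a RATE for Theorem 8.3.1, on `ℤ^{d+2}` (every `d`):

* `ratio_uniform_of_oneStepRate` (R25.L): from the two-step rate `-K N^{-1/3} ≤ b_{N+2}/b_N - μ² ≤ K N^{-1/4}`
  (tree `bridgeTwoStepRate`) and the one-step rate `|b_{N+1}/b_N - μ| ≤ K/log N` (tree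
  `bridgeRatio_rate_log`, `SAWBridgeRatioRate.lean`): UNIFORMLY for `k⁵ ≤ n`,
  `|μ^k b_{n-k}/b_n - 1| ≤ K (k n^{-1/4} + 1/log n)` (even `k`: telescoped two-step ratios; odd `k`: one
  factor `μ b_{n-1}/b_n`);
* `firstBreakLaw_rate_of_oneStepRate` (R25a): the law `P_n(K₁ = k) = λ_k b_{n-k}/b_n` of the FIRST BREAK
  POINT of a uniformly random `n`-step bridge (the bijection behind (4.2.2)) is within `K/log n` of Kesten's
  renewal law `λ_k μ^{-k}` in total variation: `Σ_{k=1}^{n} |λ_k b_{n-k}/b_n - λ_k μ^{-k}| ≤ K/log n`, `n ≥ 2`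
  (head `k ≤ n^{1/5}` by R25.L, tail by the explicit Kesten tail `kestenTail_le` and `Σ_k P_n(k) = 1`);
* `mean_breakPoints_ge_of_oneStepRate` (R25c): `E_n[#break points in [1,n-1]] = Σ_{i=1}^{n-1} b_i b_{n-i}/b_n
  ≥ (log n)/10 - K` (via (3.1.14) `half_log_le_sum_bridgeCount`).

The `_of_oneStepRate` forms take the one-step rate as an explicit hypothesis (the only place it enters);
`ratio_uniform`, `firstBreakLaw_rate`, `mean_breakPoints_ge` discharge it with the tree's
`bridgeRatio_rate_log`, so all three are UNCONDITIONAL in every dimension. The statements are the lane's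
typed `stub_R25_ratio_uniform` / `stub_R25a_firstBreakLaw_rate` / `stub_R25c_mean_breakPoints`
(a-idea-1, Sketch_G6); the cylinder form of Theorem 8.3.1 with a rate ((8.3.5)–(8.3.8)) is the sequel file.
-/

noncomputable section

open Finset Filter Topology
open scoped BigOperators

namespace Literature.Probability.RandomPlanarGeometry.SAW.Zd

/-! ### Elementary inequalities -/

/-- `(1 + x)^j ≤ 1 + 2jx` for `x ≥ 0` and `jx ≤ 1/2`. [folklore] -/
private theorem one_add_pow_le_one_add_two_mul {x : ℝ} (hx : 0 ≤ x) :
    ∀ j : ℕ, (j : ℝ) * x ≤ 1 / 2 → (1 + x) ^ j ≤ 1 + 2 * j * x := by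
  intro j
  induction j with
  | zero => intro _; simp
  | succ j ih =>
    intro hj
    have hj' : (j : ℝ) * x ≤ 1 / 2 := by
      have : (j : ℝ) * x ≤ ((j + 1 : ℕ) : ℝ) * x := by
        gcongr; exact_mod_cast Nat.le_succ j
      linarith
    have h1 := ih hj'
    have hjs : ((j + 1 : ℕ) : ℝ) = (j : ℝ) + 1 := by push_cast; ring
    rw [hjs] at hj ⊢
    have h2 : (1 + x) ^ (j + 1) = (1 + x) ^ j * (1 + x) := pow_succ _ _
    rw [h2]
    have h3 : (1 + x) ^ j * (1 + x) ≤ (1 + 2 * j * x) * (1 + x) :=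
      mul_le_mul_of_nonneg_right h1 (by linarith)
    have h4 : (1 + 2 * j * x) * (1 + x) ≤ 1 + 2 * ((j : ℝ) + 1) * x := by
      have hj0 : (0 : ℝ) ≤ j := Nat.cast_nonneg j
      nlinarith
    linarith

/-- Bernoulli: `1 - jx ≤ (1 - x)^j` for `0 ≤ x ≤ 2`. [folklore] -/
private theorem one_sub_mul_le_one_sub_pow {x : ℝ} (hx2 : x ≤ 2) (j : ℕ) :
    1 - (j : ℝ) * x ≤ (1 - x) ^ j := by
  have h := one_add_mul_le_pow (show (-2 : ℝ) ≤ -x by linarith) j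
  have h1 : (1 : ℝ) + -x = 1 - x := by ring
  rw [h1] at h
  linarith

/-- `M^{-1/4} ≤ 2 n^{-1/4}` for `1 ≤ n ≤ 2M`. [folklore] -/
private theorem rpow_neg_quarter_window' {n M : ℕ} (hn : 1 ≤ n) (hM0 : 1 ≤ M) (h2M : n ≤ 2 * M) :
    (M : ℝ) ^ (-(1 : ℝ) / 4) ≤ 2 * (n : ℝ) ^ (-(1 : ℝ) / 4) := by
  have hn0 : (0 : ℝ) ≤ n := Nat.cast_nonneg n
  have hM : (0 : ℝ) < M := by exact_mod_cast (show 0 < M by omega)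
  have hMr : (n : ℝ) / 2 ≤ M := by
    have : (n : ℝ) ≤ 2 * M := by exact_mod_cast h2M
    linarith
  have hn0' : (0 : ℝ) < n := by exact_mod_cast (show 0 < n by omega)
  have h1 : (M : ℝ) ^ (-(1 : ℝ) / 4) ≤ ((n : ℝ) / 2) ^ (-(1 : ℝ) / 4) :=
    Real.rpow_le_rpow_of_nonpos (by positivity) hMr (by norm_num)
  have h2 : ((n : ℝ) / 2) ^ (-(1 : ℝ) / 4) = (n : ℝ) ^ (-(1 : ℝ) / 4) / (2 : ℝ) ^ (-(1 : ℝ) / 4) :=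
    Real.div_rpow hn0 (by norm_num) _
  have h3 : (1 / 2 : ℝ) ≤ (2 : ℝ) ^ (-(1 : ℝ) / 4) := by
    rw [show (-(1 : ℝ) / 4) = -((1 : ℝ) / 4) by ring, Real.rpow_neg (by norm_num), one_div]
    refine inv_anti₀ (by positivity) ?_
    calc (2 : ℝ) ^ ((1 : ℝ) / 4) ≤ (2 : ℝ) ^ (1 : ℝ) :=
          Real.rpow_le_rpow_of_exponent_le (by norm_num) (by norm_num)
      _ = 2 := Real.rpow_one 2
  have h4 : 0 ≤ (n : ℝ) ^ (-(1 : ℝ) / 4) := Real.rpow_nonneg hn0 _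
  calc (M : ℝ) ^ (-(1 : ℝ) / 4) ≤ (n : ℝ) ^ (-(1 : ℝ) / 4) / (2 : ℝ) ^ (-(1 : ℝ) / 4) := by
        rw [← h2]; exact h1
    _ ≤ (n : ℝ) ^ (-(1 : ℝ) / 4) / (1 / 2) := div_le_div_of_nonneg_left h4 (by norm_num) h3
    _ = 2 * (n : ℝ) ^ (-(1 : ℝ) / 4) := by ring

/-! ### The two-step relative deviation and telescoping over even shifts -/

/-- From the two-step rate: `|b_{N+2}/(μ² b_N) - 1| ≤ (K/μ²) N^{-1/4}` for `N ≥ max N₀ 1`.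
[cite: MadrasSlade1993, Theorem 7.3.4 (d), eq. (7.3.13) (quantitative form)] -/
private theorem twoStep_relDev {d : ℕ} {K : ℝ} {N₀ : ℕ} (hK : 0 ≤ K) (hR : BridgeTwoStepRate d K N₀)
    {N : ℕ} (hN : max N₀ 1 ≤ N) :
    |(bridgeCount (d + 2) (N + 2) : ℝ) / (connectiveConstant (d + 2) ^ 2 * bridgeCount (d + 2) N) - 1| ≤
      K / connectiveConstant (d + 2) ^ 2 * (N : ℝ) ^ (-(1 : ℝ) / 4) := by
  set μ := connectiveConstant (d + 2) with hμdef
  have hμ : 0 < μ := connectiveConstant_pos (d + 2)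
  have hμ2 : 0 < μ ^ 2 := by positivity
  have hN0 : N₀ ≤ N := le_trans (le_max_left _ _) hN
  have hN1 : 1 ≤ N := le_trans (le_max_right _ _) hN
  have hN1r : (1 : ℝ) ≤ N := by exact_mod_cast hN1
  obtain ⟨h1, h2⟩ := hR N hN0
  have hbN : (0 : ℝ) < bridgeCount (d + 2) N := by exact_mod_cast one_le_bridgeCount (d := d + 2) N
  -- `N^{-1/3} ≤ N^{-1/4}`
  have h34 : (N : ℝ) ^ (-(1 : ℝ) / 3) ≤ (N : ℝ) ^ (-(1 : ℝ) / 4) :=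
    Real.rpow_le_rpow_of_exponent_le hN1r (by norm_num)
  have hr4 : 0 ≤ (N : ℝ) ^ (-(1 : ℝ) / 4) := Real.rpow_nonneg (Nat.cast_nonneg N) _
  set φ := (bridgeCount (d + 2) (N + 2) : ℝ) / bridgeCount (d + 2) N with hφ
  have habs : |φ - μ ^ 2| ≤ K * (N : ℝ) ^ (-(1 : ℝ) / 4) := by
    rw [abs_le]; constructor
    · have : K * (N : ℝ) ^ (-(1 : ℝ) / 3) ≤ K * (N : ℝ) ^ (-(1 : ℝ) / 4) :=
        mul_le_mul_of_nonneg_left h34 hK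
      linarith
    · exact h2
  have hid : (bridgeCount (d + 2) (N + 2) : ℝ) / (μ ^ 2 * bridgeCount (d + 2) N) - 1 = (φ - μ ^ 2) / μ ^ 2 := by
    rw [hφ]; field_simp
  rw [hid, abs_div, abs_of_pos hμ2, div_le_iff₀ hμ2]
  calc |φ - μ ^ 2| ≤ K * (N : ℝ) ^ (-(1 : ℝ) / 4) := habs
    _ = K / μ ^ 2 * (N : ℝ) ^ (-(1 : ℝ) / 4) * μ ^ 2 := by field_simp

/-- Telescoping over even shifts (two-sided product bounds): with `x = 2c n^{-1/4} ≤ 1` and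
`|b_{N+2}/(μ² b_N) - 1| ≤ c N^{-1/4}` for `N ≥ N₁`, for every `j` with `N₁ + 2j ≤ n`, `4j ≤ n`:
`(1 - x)^j ≤ b_n/(μ^{2j} b_{n-2j}) ≤ (1 + x)^j`.
[cite: MadrasSlade1993, Theorem 8.3.1 (proof, eq. (8.3.11), quantitative form)] -/
private theorem evenShift_prod_bounds {d : ℕ} {c : ℝ} {N₁ : ℕ} (hc : 0 ≤ c)
    (hdev : ∀ N : ℕ, N₁ ≤ N →
      |(bridgeCount (d + 2) (N + 2) : ℝ) / (connectiveConstant (d + 2) ^ 2 * bridgeCount (d + 2) N) - 1| ≤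
        c * (N : ℝ) ^ (-(1 : ℝ) / 4))
    {n : ℕ} (hn : 1 ≤ n) (hx1 : 2 * c * (n : ℝ) ^ (-(1 : ℝ) / 4) ≤ 1) :
    ∀ j : ℕ, N₁ + 2 * j ≤ n → 4 * j ≤ n →
      (1 - 2 * c * (n : ℝ) ^ (-(1 : ℝ) / 4)) ^ j ≤
          (bridgeCount (d + 2) n : ℝ) / (connectiveConstant (d + 2) ^ (2 * j) * bridgeCount (d + 2) (n - 2 * j)) ∧
        (bridgeCount (d + 2) n : ℝ) / (connectiveConstant (d + 2) ^ (2 * j) * bridgeCount (d + 2) (n - 2 * j)) ≤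
          (1 + 2 * c * (n : ℝ) ^ (-(1 : ℝ) / 4)) ^ j := by
  set μ := connectiveConstant (d + 2) with hμdef
  have hμ : 0 < μ := connectiveConstant_pos (d + 2)
  have hb : ∀ m, (0 : ℝ) < bridgeCount (d + 2) m := fun m => by
    exact_mod_cast one_le_bridgeCount (d := d + 2) m
  set x : ℝ := 2 * c * (n : ℝ) ^ (-(1 : ℝ) / 4) with hxdef
  have hx0 : 0 ≤ x := by rw [hxdef]; exact mul_nonneg (by linarith) (Real.rpow_nonneg (Nat.cast_nonneg n) _)
  intro j
  induction j with
  | zero =>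
    intro _ _
    simp only [Nat.mul_zero, pow_zero, Nat.sub_zero, one_mul]
    rw [div_self (hb n).ne']
    exact ⟨le_rfl, le_rfl⟩
  | succ j ih =>
    intro hN hj
    have hN' : N₁ + 2 * j ≤ n := by omega
    have hj' : 4 * j ≤ n := by omega
    obtain ⟨ihlo, ihhi⟩ := ih hN' hj'
    -- the new factor `f = b_{n-2j}/(μ² b_{n-2j-2})`, index `N = n - 2j - 2 ≥ N₁`, `n ≤ 2N`
    set N : ℕ := n - 2 * (j + 1) with hNdef
    have hNN₁ : N₁ ≤ N := by omega
    have hN1 : 1 ≤ N := by omega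
    have hn2N : n ≤ 2 * N := by omega
    have hNp2 : N + 2 = n - 2 * j := by omega
    have hdevN := hdev N hNN₁
    rw [hNp2] at hdevN
    have hNpow : (N : ℝ) ^ (-(1 : ℝ) / 4) ≤ 2 * (n : ℝ) ^ (-(1 : ℝ) / 4) :=
      rpow_neg_quarter_window' hn hN1 hn2N
    set f : ℝ := (bridgeCount (d + 2) (n - 2 * j) : ℝ) / (μ ^ 2 * bridgeCount (d + 2) N) with hfdef
    have hfx : |f - 1| ≤ x := by
      refine hdevN.trans ?_
      calc c * (N : ℝ) ^ (-(1 : ℝ) / 4) ≤ c * (2 * (n : ℝ) ^ (-(1 : ℝ) / 4)) :=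
            mul_le_mul_of_nonneg_left hNpow hc
        _ = x := by rw [hxdef]; ring
    have hflo : 1 - x ≤ f := by have := (abs_le.1 hfx).1; linarith
    have hfhi : f ≤ 1 + x := by have := (abs_le.1 hfx).2; linarith
    have hf0 : 0 ≤ f := by rw [hfdef]; exact div_nonneg (hb _).le (by positivity)
    -- `r_{j+1} = r_j * f`
    have hprod : (bridgeCount (d + 2) n : ℝ) / (μ ^ (2 * (j + 1)) * bridgeCount (d + 2) (n - 2 * (j + 1))) =
        (bridgeCount (d + 2) n : ℝ) / (μ ^ (2 * j) * bridgeCount (d + 2) (n - 2 * j)) * f := by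
      rw [hfdef, ← hNdef]
      have hb1 := (hb (n - 2 * j)).ne'
      have hb2 := (hb N).ne'
      have hμ0 : μ ≠ 0 := hμ.ne'
      have hμ2j : μ ^ (2 * (j + 1)) = μ ^ (2 * j) * μ ^ 2 := by
        rw [show 2 * (j + 1) = 2 * j + 2 by ring, pow_add]
      rw [hμ2j]
      field_simp
    rw [hprod, pow_succ, pow_succ]
    have hlo0 : 0 ≤ 1 - x := by linarith
    constructor
    · exact mul_le_mul ihlo hflo hlo0 (le_trans (pow_nonneg hlo0 j) ihlo)
    · exact mul_le_mul ihhi hfhi hf0 (pow_nonneg (by linarith) j)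

/-- Even shifts: with `x = 2c n^{-1/4}` and `jx ≤ 1/2` (and the hypotheses of the product bounds),
`|μ^{2j} b_{n-2j}/b_n - 1| ≤ 4jx`. [cite: MadrasSlade1993, Theorem 8.3.1 (proof, eq. (8.3.11), quantitative form)] -/
private theorem evenShift_ratio {d : ℕ} {c : ℝ} {N₁ : ℕ} (hc : 0 ≤ c)
    (hdev : ∀ N : ℕ, N₁ ≤ N →
      |(bridgeCount (d + 2) (N + 2) : ℝ) / (connectiveConstant (d + 2) ^ 2 * bridgeCount (d + 2) N) - 1| ≤
        c * (N : ℝ) ^ (-(1 : ℝ) / 4))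
    {n j : ℕ} (hn : 1 ≤ n) (hN : N₁ + 2 * j ≤ n) (hj : 4 * j ≤ n)
    (hx1 : 2 * c * (n : ℝ) ^ (-(1 : ℝ) / 4) ≤ 1)
    (hjx : (j : ℝ) * (2 * c * (n : ℝ) ^ (-(1 : ℝ) / 4)) ≤ 1 / 2) :
    |connectiveConstant (d + 2) ^ (2 * j) * (bridgeCount (d + 2) (n - 2 * j) : ℝ) / bridgeCount (d + 2) n - 1| ≤
      4 * j * (2 * c * (n : ℝ) ^ (-(1 : ℝ) / 4)) := by
  set μ := connectiveConstant (d + 2) with hμdef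
  have hμ : 0 < μ := connectiveConstant_pos (d + 2)
  have hb : ∀ m, (0 : ℝ) < bridgeCount (d + 2) m := fun m => by
    exact_mod_cast one_le_bridgeCount (d := d + 2) m
  set x : ℝ := 2 * c * (n : ℝ) ^ (-(1 : ℝ) / 4) with hxdef
  have hx0 : 0 ≤ x := by rw [hxdef]; exact mul_nonneg (by linarith) (Real.rpow_nonneg (Nat.cast_nonneg n) _)
  obtain ⟨hlo, hhi⟩ := evenShift_prod_bounds hc hdev hn hx1 j hN hj
  set r : ℝ := (bridgeCount (d + 2) n : ℝ) / (μ ^ (2 * j) * bridgeCount (d + 2) (n - 2 * j)) with hrdef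
  have hj0 : (0 : ℝ) ≤ j := Nat.cast_nonneg j
  have hrlo : 1 - j * x ≤ r := le_trans (one_sub_mul_le_one_sub_pow (by linarith) j) hlo
  have hrhi : r ≤ 1 + 2 * j * x := le_trans hhi (one_add_pow_le_one_add_two_mul hx0 j hjx)
  have hrpos : 1 / 2 ≤ r := by linarith
  have hr0 : 0 < r := by linarith
  -- the target quantity is `1/r`
  have hq : μ ^ (2 * j) * (bridgeCount (d + 2) (n - 2 * j) : ℝ) / bridgeCount (d + 2) n = r⁻¹ := by
    rw [hrdef, inv_div]
  rw [hq]
  have hr0' : r ≠ 0 := hr0.ne'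
  have hid : r⁻¹ - 1 = (1 - r) / r := by field_simp
  rw [hid, abs_div, abs_of_pos hr0, div_le_iff₀ hr0]
  have h1 : |1 - r| ≤ 2 * j * x := by
    rw [abs_le]; constructor <;> linarith
  calc |1 - r| ≤ 2 * j * x := h1
    _ = 4 * j * x * (1 / 2) := by ring
    _ ≤ 4 * j * x * r := mul_le_mul_of_nonneg_left hrpos (by positivity)

/-- Odd shifts: `μ^{2j+1} b_{n-2j-1}/b_n = (μ^{2j} b_{(n-1)-2j}/b_{n-1}) · (μ b_{n-1}/b_n)`; the first
factor is an even shift at `n - 1`, the second is `1 + O(1/log n)` by the one-step rate.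
[cite: MadrasSlade1993, Theorem 8.3.1 (proof, eq. (8.3.11), quantitative form)] -/
private theorem oddShift_ratio {d : ℕ} {c K₂ : ℝ} {N₁ : ℕ} (hc : 0 ≤ c) (hK₂ : 0 ≤ K₂)
    (hdev : ∀ N : ℕ, N₁ ≤ N →
      |(bridgeCount (d + 2) (N + 2) : ℝ) / (connectiveConstant (d + 2) ^ 2 * bridgeCount (d + 2) N) - 1| ≤
        c * (N : ℝ) ^ (-(1 : ℝ) / 4))
    (hR16 : ∀ N : ℕ, 2 ≤ N →
      |(bridgeCount (d + 2) (N + 1) : ℝ) / bridgeCount (d + 2) N - connectiveConstant (d + 2)| ≤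
        K₂ / Real.log N)
    {n j : ℕ} (hn : 3 ≤ n) (hN : N₁ + 2 * j ≤ n - 1) (hj : 4 * j ≤ n - 1)
    (hx1 : 4 * c * (n : ℝ) ^ (-(1 : ℝ) / 4) ≤ 1)
    (hjx : (j : ℝ) * (4 * c * (n : ℝ) ^ (-(1 : ℝ) / 4)) ≤ 1 / 2)
    (hlog : 4 * K₂ / connectiveConstant (d + 2) ≤ Real.log n) :
    |connectiveConstant (d + 2) ^ (2 * j + 1) * (bridgeCount (d + 2) (n - (2 * j + 1)) : ℝ) /
        bridgeCount (d + 2) n - 1| ≤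
      32 * j * c * (n : ℝ) ^ (-(1 : ℝ) / 4) + 4 * K₂ / (connectiveConstant (d + 2) * Real.log n) := by
  set μ := connectiveConstant (d + 2) with hμdef
  have hμ : 0 < μ := connectiveConstant_pos (d + 2)
  have hb : ∀ m, (0 : ℝ) < bridgeCount (d + 2) m := fun m => by
    exact_mod_cast one_le_bridgeCount (d := d + 2) m
  have hn1 : 1 ≤ n - 1 := by omega
  have hn0 : (0 : ℝ) < n := by exact_mod_cast (show 0 < n by omega)
  have hn1r : (1 : ℝ) ≤ ((n - 1 : ℕ) : ℝ) := by exact_mod_cast hn1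
  have hlogn : 0 < Real.log n := Real.log_pos (by exact_mod_cast (show 1 < n by omega))
  have hr0 : 0 ≤ (n : ℝ) ^ (-(1 : ℝ) / 4) := Real.rpow_nonneg hn0.le _
  -- `(n-1)^{-1/4} ≤ 2 n^{-1/4}`
  have hpow : ((n - 1 : ℕ) : ℝ) ^ (-(1 : ℝ) / 4) ≤ 2 * (n : ℝ) ^ (-(1 : ℝ) / 4) :=
    rpow_neg_quarter_window' (by omega) hn1 (by omega)
  -- the even factor at `n - 1`
  have hcmp : 2 * c * ((n - 1 : ℕ) : ℝ) ^ (-(1 : ℝ) / 4) ≤ 4 * c * (n : ℝ) ^ (-(1 : ℝ) / 4) := by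
    have := mul_le_mul_of_nonneg_left hpow hc
    linarith
  have hx1' : 2 * c * ((n - 1 : ℕ) : ℝ) ^ (-(1 : ℝ) / 4) ≤ 1 := hcmp.trans hx1
  have hjx' : (j : ℝ) * (2 * c * ((n - 1 : ℕ) : ℝ) ^ (-(1 : ℝ) / 4)) ≤ 1 / 2 := by
    have hj0 : (0 : ℝ) ≤ j := Nat.cast_nonneg j
    exact (mul_le_mul_of_nonneg_left hcmp hj0).trans hjx
  have hA := evenShift_ratio hc hdev hn1 hN hj hx1' hjx'
  set A : ℝ := μ ^ (2 * j) * (bridgeCount (d + 2) (n - 1 - 2 * j) : ℝ) / bridgeCount (d + 2) (n - 1) with hAdef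
  have hA' : |A - 1| ≤ 16 * j * c * (n : ℝ) ^ (-(1 : ℝ) / 4) := by
    refine hA.trans ?_
    have hj0 : (0 : ℝ) ≤ j := Nat.cast_nonneg j
    calc 4 * (j : ℝ) * (2 * c * ((n - 1 : ℕ) : ℝ) ^ (-(1 : ℝ) / 4))
        ≤ 4 * (j : ℝ) * (2 * c * (2 * (n : ℝ) ^ (-(1 : ℝ) / 4))) := by gcongr
      _ = 16 * j * c * (n : ℝ) ^ (-(1 : ℝ) / 4) := by ring
  -- the one-step factor `B = μ b_{n-1}/b_n`
  set t : ℝ := (bridgeCount (d + 2) n : ℝ) / bridgeCount (d + 2) (n - 1) with htdef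
  have ht0 : 0 < t := by rw [htdef]; exact div_pos (hb n) (hb (n - 1))
  have hR := hR16 (n - 1) (by omega)
  rw [show n - 1 + 1 = n by omega] at hR
  -- `log(n-1) ≥ log n / 2` for `n ≥ 3`
  have hlog1 : Real.log n / 2 ≤ Real.log ((n - 1 : ℕ) : ℝ) := by
    have h3 : (n : ℝ) ≤ ((n - 1 : ℕ) : ℝ) ^ 2 := by
      have hm : (2 : ℝ) ≤ ((n - 1 : ℕ) : ℝ) := by exact_mod_cast (show 2 ≤ n - 1 by omega)
      have hn' : (n : ℝ) = ((n - 1 : ℕ) : ℝ) + 1 := by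
        have : n = (n - 1) + 1 := by omega
        exact_mod_cast this
      rw [hn']; nlinarith
    have h4 : Real.log n ≤ Real.log (((n - 1 : ℕ) : ℝ) ^ 2) := Real.log_le_log hn0 h3
    rw [Real.log_pow] at h4; push_cast at h4; linarith
  have hlog1pos : 0 < Real.log ((n - 1 : ℕ) : ℝ) := by linarith
  set e : ℝ := K₂ / Real.log ((n - 1 : ℕ) : ℝ) with hedef
  have he : e ≤ 2 * K₂ / Real.log n := by
    rw [hedef, div_le_div_iff₀ hlog1pos hlogn]
    have := mul_le_mul_of_nonneg_left hlog1 hK₂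
    linarith
  have he0 : 0 ≤ e := by positivity
  have htμ : |t - μ| ≤ e := hR
  -- `e ≤ μ/2`
  have heμ : e ≤ μ / 2 := by
    refine he.trans ?_
    rw [div_le_iff₀ hlogn]
    have : 4 * K₂ ≤ Real.log n * μ := by rwa [div_le_iff₀ hμ] at hlog
    linarith
  have htlo : μ / 2 ≤ t := by have := (abs_le.1 htμ).1; linarith
  set B : ℝ := μ / t with hBdef
  have hB1 : |B - 1| ≤ 2 * e / μ := by
    have hid : B - 1 = (μ - t) / t := by rw [hBdef]; field_simp
    rw [hid, abs_div, abs_of_pos ht0, div_le_iff₀ ht0]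
    calc |μ - t| = |t - μ| := abs_sub_comm _ _
      _ ≤ e := htμ
      _ = 2 * e / μ * (μ / 2) := by field_simp
      _ ≤ 2 * e / μ * t := mul_le_mul_of_nonneg_left htlo (by positivity)
  have hB2 : B ≤ 2 := by
    rw [hBdef, div_le_iff₀ ht0]; linarith
  have hB0 : 0 ≤ B := by positivity
  -- the target is `A * B`
  have hq : μ ^ (2 * j + 1) * (bridgeCount (d + 2) (n - (2 * j + 1)) : ℝ) / bridgeCount (d + 2) n = A * B := by
    rw [hAdef, hBdef, htdef, show n - (2 * j + 1) = n - 1 - 2 * j by omega, pow_succ]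
    have := (hb n).ne'; have := (hb (n - 1)).ne'
    field_simp
  rw [hq]
  have hsplit : A * B - 1 = (A - 1) * B + (B - 1) := by ring
  rw [hsplit]
  calc |(A - 1) * B + (B - 1)| ≤ |(A - 1) * B| + |B - 1| := abs_add_le _ _
    _ = |A - 1| * B + |B - 1| := by rw [abs_mul, abs_of_nonneg hB0]
    _ ≤ 16 * j * c * (n : ℝ) ^ (-(1 : ℝ) / 4) * 2 + 2 * e / μ := by
        have hj0 : (0 : ℝ) ≤ 16 * (j : ℝ) := by positivity
        have h1 : |A - 1| * B ≤ 16 * j * c * (n : ℝ) ^ (-(1 : ℝ) / 4) * 2 :=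
          mul_le_mul hA' hB2 hB0 (mul_nonneg (mul_nonneg hj0 hc) hr0)
        linarith [hB1]
    _ ≤ 32 * j * c * (n : ℝ) ^ (-(1 : ℝ) / 4) + 4 * K₂ / (μ * Real.log n) := by
        have h1 : 2 * e / μ ≤ 4 * K₂ / (μ * Real.log n) := by
          rw [div_le_div_iff₀ hμ (by positivity)]
          have := he
          rw [le_div_iff₀ hlogn] at this
          nlinarith
        linarith

/-! ### R25.L — the uniform ratio lemma -/

/-- `k⁵ ≤ n` gives `k ≤ n^{1/5}` (as reals). [folklore] -/
private theorem natCast_le_rpow_fifth {k n : ℕ} (hk : k ^ 5 ≤ n) : (k : ℝ) ≤ (n : ℝ) ^ ((1 : ℝ) / 5) := by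
  have hk' : ((k : ℝ) ^ 5) ≤ (n : ℝ) := by exact_mod_cast hk
  have h5 : ((k : ℝ) ^ 5) ^ ((1 : ℝ) / 5) = k := by
    rw [show ((1 : ℝ) / 5) = ((5 : ℕ) : ℝ)⁻¹ by norm_num]
    exact Real.pow_rpow_inv_natCast (Nat.cast_nonneg k) (by norm_num)
  rw [← h5]
  exact Real.rpow_le_rpow (by positivity) hk' (by norm_num)

/-- `k⁵ ≤ n` and `n ≥ 4` give `4k ≤ n`. [folklore] -/
private theorem four_mul_le_of_pow_five_le {k n : ℕ} (hk : k ^ 5 ≤ n) (hn : 4 ≤ n) : 4 * k ≤ n := by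
  by_cases hk2 : 2 ≤ k
  · have h16 : 2 ^ 4 ≤ k ^ 4 := Nat.pow_le_pow_left hk2 4
    have : 16 * k ≤ k ^ 5 := by
      rw [show k ^ 5 = k ^ 4 * k by ring]
      have : (16 : ℕ) ≤ k ^ 4 := by simpa using h16
      exact Nat.mul_le_mul_right k this
    omega
  · omega

/-- **R25.L — the uniform ratio lemma** (every `d`; modulo a one-step rate `hR16`): there are `K ≥ 0` and
`N₀` such that for all `n ≥ N₀` and all shifts `k` with `k⁵ ≤ n`,
`|μ^k b_{n-k}/b_n - 1| ≤ K (k n^{-1/4} + 1/log n)`.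
Even `k`: telescoped two-step ratios (tree `exists_bridgeTwoStepRate`); odd `k`: one factor `μ b_{n-1}/b_n`
controlled by the one-step rate. [cite: MadrasSlade1993, Theorem 8.3.1 (proof, eq. (8.3.11); quantitative form, derived)] -/
theorem ratio_uniform_of_oneStepRate (d : ℕ)
    (hR16 : ∃ K : ℝ, ∀ N : ℕ, 2 ≤ N →
      |(bridgeCount (d + 2) (N + 1) : ℝ) / bridgeCount (d + 2) N - connectiveConstant (d + 2)| ≤
        K / Real.log N) :
    ∃ K : ℝ, 0 ≤ K ∧ ∃ N₀ : ℕ, ∀ n : ℕ, N₀ ≤ n → ∀ k : ℕ, k ^ 5 ≤ n →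
      |connectiveConstant (d + 2) ^ k * (bridgeCount (d + 2) (n - k) : ℝ) / bridgeCount (d + 2) n - 1| ≤
        K * ((k : ℝ) * (n : ℝ) ^ (-(1 : ℝ) / 4) + 1 / Real.log n) := by
  set μ := connectiveConstant (d + 2) with hμdef
  have hμ : 0 < μ := connectiveConstant_pos (d + 2)
  -- R19 input
  obtain ⟨K₁, hK₁, N₀, hR⟩ := exists_bridgeTwoStepRate d
  set c : ℝ := K₁ / μ ^ 2 with hcdef
  have hc : 0 ≤ c := by positivity
  set N₁ : ℕ := max N₀ 1 with hN₁
  have hdev : ∀ N : ℕ, N₁ ≤ N →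
      |(bridgeCount (d + 2) (N + 2) : ℝ) / (μ ^ 2 * bridgeCount (d + 2) N) - 1| ≤ c * (N : ℝ) ^ (-(1 : ℝ) / 4) :=
    fun N hN => twoStep_relDev hK₁ hR hN
  -- R16 input, with a nonnegative constant
  obtain ⟨K₂', hR16'⟩ := hR16
  set K₂ : ℝ := max K₂' 0 with hK₂def
  have hK₂ : 0 ≤ K₂ := le_max_right _ _
  have hR16K : ∀ N : ℕ, 2 ≤ N →
      |(bridgeCount (d + 2) (N + 1) : ℝ) / bridgeCount (d + 2) N - μ| ≤ K₂ / Real.log N := by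
    intro N hN
    refine (hR16' N hN).trans ?_
    have hlog : 0 < Real.log N := Real.log_pos (by exact_mod_cast (show 1 < N by omega))
    exact div_le_div_of_nonneg_right (le_max_left _ _) hlog.le
  -- thresholds
  have heva : ∀ᶠ n : ℕ in atTop, 2 * N₁ + 6 ≤ n := eventually_ge_atTop _
  have ht0 : Tendsto (fun n : ℕ => (n : ℝ) ^ (-((1 : ℝ) / 20))) atTop (𝓝 0) :=
    (tendsto_rpow_neg_atTop (by norm_num : (0 : ℝ) < 1 / 20)).comp tendsto_natCast_atTop_atTop
  have ht : Tendsto (fun n : ℕ => 4 * c * (n : ℝ) ^ (-((1 : ℝ) / 20))) atTop (𝓝 0) := by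
    simpa using ht0.const_mul (4 * c)
  have hevb : ∀ᶠ n : ℕ in atTop, 4 * c * (n : ℝ) ^ (-((1 : ℝ) / 20)) ≤ 1 / 2 :=
    ht.eventually (ge_mem_nhds (by norm_num : (0 : ℝ) < 1 / 2))
  have hevc : ∀ᶠ n : ℕ in atTop, 4 * K₂ / μ ≤ Real.log n :=
    (Real.tendsto_log_atTop.comp tendsto_natCast_atTop_atTop).eventually_ge_atTop _
  obtain ⟨N₂, hN₂⟩ := eventually_atTop.1 ((heva.and hevb).and hevc)
  refine ⟨16 * c + 4 * K₂ / μ, by positivity, N₂, fun n hn k hk => ?_⟩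
  obtain ⟨⟨ha, hb⟩, hlogc⟩ := hN₂ n hn
  have hn0 : (0 : ℝ) < n := by exact_mod_cast (show 0 < n by omega)
  have hn1r : (1 : ℝ) ≤ n := by exact_mod_cast (show 1 ≤ n by omega)
  have hlogn : 0 < Real.log n := Real.log_pos (by exact_mod_cast (show 1 < n by omega))
  -- rpow bookkeeping
  set r4 : ℝ := (n : ℝ) ^ (-(1 : ℝ) / 4) with hr4def
  set r20 : ℝ := (n : ℝ) ^ (-((1 : ℝ) / 20)) with hr20def
  have hr4 : 0 ≤ r4 := Real.rpow_nonneg hn0.le _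
  have hr4_20 : r4 ≤ r20 := Real.rpow_le_rpow_of_exponent_le hn1r (by norm_num)
  have hk5 : (k : ℝ) ≤ (n : ℝ) ^ ((1 : ℝ) / 5) := natCast_le_rpow_fifth hk
  have hkr : (k : ℝ) * r4 ≤ r20 := by
    have h1 : (k : ℝ) * r4 ≤ (n : ℝ) ^ ((1 : ℝ) / 5) * r4 := mul_le_mul_of_nonneg_right hk5 hr4
    have h2 : (n : ℝ) ^ ((1 : ℝ) / 5) * r4 = r20 := by
      rw [hr4def, hr20def, ← Real.rpow_add hn0]; norm_num
    linarith
  have h4k : 4 * k ≤ n := four_mul_le_of_pow_five_le hk (by omega)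
  have hk0 : (0 : ℝ) ≤ k := Nat.cast_nonneg k
  have hcr : 2 * c * ((k : ℝ) * r4) ≤ 1 / 4 := by nlinarith
  have hx1 : 4 * c * r4 ≤ 1 := by nlinarith
  have hKlog : 0 ≤ (16 * c + 4 * K₂ / μ) * (1 / Real.log n) := by positivity
  obtain ⟨j, rfl | rfl⟩ := Nat.even_or_odd' k
  · -- even shift `k = 2j`
    have hjx : (j : ℝ) * (2 * c * (n : ℝ) ^ (-(1 : ℝ) / 4)) ≤ 1 / 2 := by
      have : (j : ℝ) ≤ ((2 * j : ℕ) : ℝ) := by exact_mod_cast (show j ≤ 2 * j by omega)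
      rw [← hr4def]; nlinarith
    have h := evenShift_ratio hc hdev (show 1 ≤ n by omega) (show N₁ + 2 * j ≤ n by omega)
      (show 4 * j ≤ n by omega) (by rw [← hr4def]; linarith) hjx
    refine h.trans ?_
    rw [← hr4def]
    have hj2 : ((2 * j : ℕ) : ℝ) = 2 * (j : ℝ) := by push_cast; ring
    rw [hj2] at hkr ⊢
    have hj0 : (0 : ℝ) ≤ j := Nat.cast_nonneg j
    calc 4 * (j : ℝ) * (2 * c * r4) = 4 * c * ((2 * (j : ℝ)) * r4) := by ring
      _ ≤ (16 * c + 4 * K₂ / μ) * ((2 * (j : ℝ)) * r4) := by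
          apply mul_le_mul_of_nonneg_right _ (by positivity)
          have : 0 ≤ 4 * K₂ / μ := by positivity
          linarith
      _ ≤ (16 * c + 4 * K₂ / μ) * ((2 * (j : ℝ)) * r4 + 1 / Real.log n) := by
          apply mul_le_mul_of_nonneg_left _ (by positivity)
          have : 0 ≤ 1 / Real.log n := by positivity
          linarith
  · -- odd shift `k = 2j + 1`
    have hjx : (j : ℝ) * (4 * c * (n : ℝ) ^ (-(1 : ℝ) / 4)) ≤ 1 / 2 := by
      have : 2 * (j : ℝ) ≤ ((2 * j + 1 : ℕ) : ℝ) := by exact_mod_cast (show 2 * j ≤ 2 * j + 1 by omega)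
      rw [← hr4def]; nlinarith
    have h := oddShift_ratio hc hK₂ hdev hR16K (show 3 ≤ n by omega) (show N₁ + 2 * j ≤ n - 1 by omega)
      (show 4 * j ≤ n - 1 by omega) (by rw [← hr4def]; linarith) hjx hlogc
    refine h.trans ?_
    rw [← hr4def]
    have hj2 : ((2 * j + 1 : ℕ) : ℝ) = 2 * (j : ℝ) + 1 := by push_cast; ring
    rw [hj2] at hkr ⊢
    have hj0 : (0 : ℝ) ≤ j := Nat.cast_nonneg j
    have hKμ : 0 ≤ 4 * K₂ / μ := by positivity
    have h1 : 32 * (j : ℝ) * c * r4 ≤ 16 * c * ((2 * (j : ℝ) + 1) * r4) := by nlinarith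
    have h2 : 4 * K₂ / (μ * Real.log n) = 4 * K₂ / μ * (1 / Real.log n) := by
      field_simp
    rw [h2]
    have p1 : 0 ≤ c * (1 / Real.log n) := mul_nonneg hc (by positivity)
    have p2 : 0 ≤ 4 * K₂ / μ * ((2 * (j : ℝ) + 1) * r4) :=
      mul_nonneg hKμ (mul_nonneg (by positivity) hr4)
    have p3 : 0 ≤ c * r4 := mul_nonneg hc hr4
    linarith [p1, p2, p3]

/-! ### R25a — the first-break-point law of a uniform bridge vs Kesten's renewal law -/

/-- `Σ_{1 ≤ k ≤ n} g k = Σ_{k < n} g (k+1)`. [folklore] -/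
private theorem sum_Icc_one_eq_sum_range'' (g : ℕ → ℝ) (n : ℕ) :
    ∑ k ∈ Icc 1 n, g k = ∑ k ∈ range n, g (k + 1) := by
  induction n with
  | zero => simp
  | succ n ih => rw [Finset.sum_Icc_succ_top (by omega), ih, Finset.sum_range_succ]

/-- Splitting `Σ_{1 ≤ k ≤ n}` at `T ≤ n`. [folklore] -/
private theorem sum_Icc_split (f : ℕ → ℝ) {T n : ℕ} (hT : T ≤ n) :
    ∑ k ∈ Icc 1 n, f k = ∑ k ∈ Icc 1 T, f k + ∑ k ∈ Ico (T + 1) (n + 1), f k := by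
  have h1 : Icc 1 n = Ico 1 (n + 1) := (Finset.Ico_add_one_right_eq_Icc 1 n).symm
  have h2 : Icc 1 T = Ico 1 (T + 1) := (Finset.Ico_add_one_right_eq_Icc 1 T).symm
  rw [h1, h2]
  exact (Finset.sum_Ico_consecutive f (by omega) (by omega)).symm

/-- `n^{-1/20} ≤ 20/log n` for `n ≥ 2` (from `log x ≤ 20 x^{1/20}`). [folklore] -/
private theorem rpow_neg_twentieth_le {n : ℕ} (hn : 2 ≤ n) :
    (n : ℝ) ^ (-((1 : ℝ) / 20)) ≤ 20 / Real.log n := by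
  have hn0 : (0 : ℝ) < n := by exact_mod_cast (show 0 < n by omega)
  have hlogn : 0 < Real.log n := Real.log_pos (by exact_mod_cast (show 1 < n by omega))
  have h := Real.log_le_rpow_div hn0.le (by norm_num : (0 : ℝ) < 1 / 20)
  have hp : 0 < (n : ℝ) ^ ((1 : ℝ) / 20) := Real.rpow_pos_of_pos hn0 _
  rw [Real.rpow_neg hn0.le, inv_eq_one_div, div_le_div_iff₀ hp hlogn]
  have : Real.log n ≤ 20 * (n : ℝ) ^ ((1 : ℝ) / 20) := by
    have h' : (n : ℝ) ^ ((1 : ℝ) / 20) / (1 / 20) = 20 * (n : ℝ) ^ ((1 : ℝ) / 20) := by ring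
    linarith [h'.symm ▸ h]
  linarith

/-- `T = ⌊n^{1/5}⌋` bookkeeping: for `2μ ≤ n^{1/5}` and `10 log(2μ) ≤ log n` (`n ≥ 2`):
`1 ≤ T`, `T⁵ ≤ n`, `μ ≤ T`, `(T:ℝ) ≤ n^{1/5}`, `(T:ℝ) ≤ n - 1` and `log n / 10 ≤ log (T/μ)`. [folklore] -/
private theorem floor_fifth_facts {d n : ℕ} (hn : 2 ≤ n)
    (hμy : 2 * connectiveConstant (d + 2) ≤ (n : ℝ) ^ ((1 : ℝ) / 5))
    (hlog : 10 * Real.log (2 * connectiveConstant (d + 2)) ≤ Real.log n) :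
    1 ≤ ⌊(n : ℝ) ^ ((1 : ℝ) / 5)⌋₊ ∧ ⌊(n : ℝ) ^ ((1 : ℝ) / 5)⌋₊ ^ 5 ≤ n ∧
      connectiveConstant (d + 2) ≤ ⌊(n : ℝ) ^ ((1 : ℝ) / 5)⌋₊ ∧
      (⌊(n : ℝ) ^ ((1 : ℝ) / 5)⌋₊ : ℝ) ≤ (n : ℝ) ^ ((1 : ℝ) / 5) ∧
      (⌊(n : ℝ) ^ ((1 : ℝ) / 5)⌋₊ : ℝ) ≤ (n : ℝ) - 1 ∧
      Real.log n / 10 ≤ Real.log ((⌊(n : ℝ) ^ ((1 : ℝ) / 5)⌋₊ : ℝ) / connectiveConstant (d + 2)) := by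
  set μ := connectiveConstant (d + 2) with hμdef
  have hμ : 0 < μ := connectiveConstant_pos (d + 2)
  have hμ1 : 1 ≤ μ := one_le_connectiveConstant (d + 2)
  have hn0 : (0 : ℝ) < n := by exact_mod_cast (show 0 < n by omega)
  set y : ℝ := (n : ℝ) ^ ((1 : ℝ) / 5) with hydef
  have hy2 : 2 ≤ y := by linarith
  have hy0 : 0 < y := by linarith
  have hy5 : y ^ 5 = n := by
    rw [hydef, show ((1 : ℝ) / 5) = ((5 : ℕ) : ℝ)⁻¹ by norm_num]
    exact Real.rpow_inv_natCast_pow hn0.le (by norm_num)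
  set T : ℕ := ⌊y⌋₊ with hTdef
  have hT1 : 1 ≤ T := (Nat.one_le_floor_iff y).2 (by linarith)
  have hTy : (T : ℝ) ≤ y := Nat.floor_le hy0.le
  have hyT : y < T + 1 := Nat.lt_floor_add_one y
  have hT5 : T ^ 5 ≤ n := by
    have : (T : ℝ) ^ 5 ≤ y ^ 5 := pow_le_pow_left₀ (Nat.cast_nonneg T) hTy 5
    rw [hy5] at this
    exact_mod_cast this
  have hTμ : μ ≤ T := by linarith
  have hTn : (T : ℝ) ≤ (n : ℝ) - 1 := by
    -- `y ≤ n - 1` since `n = y^5 ≥ 16 y ≥ y + 1`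
    have h16 : (2 : ℝ) ^ 4 ≤ y ^ 4 := pow_le_pow_left₀ (by norm_num) hy2 4
    have : y + 1 ≤ y ^ 5 := by nlinarith
    linarith
  have hlogT : Real.log n / 10 ≤ Real.log ((T : ℝ) / μ) := by
    have hT0 : (0 : ℝ) < T := by exact_mod_cast (show 0 < T by omega)
    have hTy2 : y / (2 * μ) ≤ (T : ℝ) / μ := by
      rw [div_le_div_iff₀ (by positivity) hμ]; nlinarith
    have h1 : Real.log (y / (2 * μ)) ≤ Real.log ((T : ℝ) / μ) :=
      Real.log_le_log (by positivity) hTy2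
    have h2 : Real.log (y / (2 * μ)) = Real.log y - Real.log (2 * μ) :=
      Real.log_div hy0.ne' (by positivity)
    have h3 : Real.log y = (1 : ℝ) / 5 * Real.log n := by rw [hydef, Real.log_rpow hn0]
    linarith
  exact ⟨hT1, hT5, hTμ, hTy, hTn, hlogT⟩

/-- **Head/tail control of the first-break-point law** (the quantitative core of Madras–Slade
(8.3.9)–(8.3.13)): if `|μ^k b_{n-k}/b_n - 1| ≤ K(k n^{-1/4} + 1/log n)` for all `k⁵ ≤ n` (`K ≥ 0`, `n ≥ 2`),
then for every `T` with `T⁵ ≤ n`, writing `P_k = λ_k b_{n-k}/b_n` (first-break-point law of a uniform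
`n`-bridge), `p_k = λ_k μ^{-k}` (Kesten's law) and `θ = K(T n^{-1/4} + 1/log n)`:
`Σ_{k ≤ T} |P_k - p_k| ≤ θ` and `Σ_{T < k ≤ n} P_k ≤ (1 - Σ_{k ≤ T} p_k) + θ`.
[cite: MadrasSlade1993, Theorem 8.3.1 (proof, eqs. (8.3.9)–(8.3.13); quantitative form, derived)] -/
theorem firstBreakLaw_head_tail {d : ℕ} {K : ℝ} (hK : 0 ≤ K) {n : ℕ} (hn : 2 ≤ n)
    (hL : ∀ k : ℕ, k ^ 5 ≤ n →
      |connectiveConstant (d + 2) ^ k * (bridgeCount (d + 2) (n - k) : ℝ) / bridgeCount (d + 2) n - 1| ≤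
        K * ((k : ℝ) * (n : ℝ) ^ (-(1 : ℝ) / 4) + 1 / Real.log n))
    {T : ℕ} (hT5 : T ^ 5 ≤ n) :
    (∑ k ∈ Icc 1 T, |(irreducibleBridgeCount (d + 2) k : ℝ) * (bridgeCount (d + 2) (n - k) : ℝ) /
          bridgeCount (d + 2) n - (irreducibleBridgeCount (d + 2) k : ℝ) / connectiveConstant (d + 2) ^ k| ≤
      K * ((T : ℝ) * (n : ℝ) ^ (-(1 : ℝ) / 4) + 1 / Real.log n)) ∧
    (∑ k ∈ Ico (T + 1) (n + 1), (irreducibleBridgeCount (d + 2) k : ℝ) * (bridgeCount (d + 2) (n - k) : ℝ) /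
          bridgeCount (d + 2) n ≤
      (1 - ∑ k ∈ Icc 1 T, (irreducibleBridgeCount (d + 2) k : ℝ) / connectiveConstant (d + 2) ^ k) +
        K * ((T : ℝ) * (n : ℝ) ^ (-(1 : ℝ) / 4) + 1 / Real.log n)) := by
  set μ := connectiveConstant (d + 2) with hμdef
  have hμ : 0 < μ := connectiveConstant_pos (d + 2)
  have hn0 : (0 : ℝ) < n := by exact_mod_cast (show 0 < n by omega)
  have hn1 : 1 ≤ n := by omega
  have hlogn : 0 < Real.log n := Real.log_pos (by exact_mod_cast (show 1 < n by omega))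
  have hb : ∀ m, (0 : ℝ) < bridgeCount (d + 2) m := fun m => by
    exact_mod_cast one_le_bridgeCount (d := d + 2) m
  have hTn : T ≤ n := le_trans (Nat.le_self_pow (by norm_num) T) hT5
  set P : ℕ → ℝ := fun k =>
    (irreducibleBridgeCount (d + 2) k : ℝ) * (bridgeCount (d + 2) (n - k) : ℝ) / bridgeCount (d + 2) n with hPdef
  set p : ℕ → ℝ := fun k => (irreducibleBridgeCount (d + 2) k : ℝ) / μ ^ k with hpdef
  set r4 : ℝ := (n : ℝ) ^ (-(1 : ℝ) / 4) with hr4def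
  set θ : ℝ := K * ((T : ℝ) * r4 + 1 / Real.log n) with hθdef
  show (∑ k ∈ Icc 1 T, |P k - p k| ≤ θ) ∧ (∑ k ∈ Ico (T + 1) (n + 1), P k ≤ (1 - ∑ k ∈ Icc 1 T, p k) + θ)
  have hr4 : 0 ≤ r4 := Real.rpow_nonneg hn0.le _
  have hθ0 : 0 ≤ θ := by positivity
  have hP0 : ∀ k, 0 ≤ P k := fun k => by
    simp only [hPdef]; exact div_nonneg (by positivity) (hb n).le
  have hp0 : ∀ k, 0 ≤ p k := fun k => by simp only [hpdef]; positivity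
  have hPsum : ∑ k ∈ Icc 1 n, P k = 1 := by
    have h := bridgeCount_eq_sum_Icc (d := d + 2) hn1
    have h' : (bridgeCount (d + 2) n : ℝ) =
        ∑ s ∈ Icc 1 n, (irreducibleBridgeCount (d + 2) s : ℝ) * (bridgeCount (d + 2) (n - s) : ℝ) := by
      exact_mod_cast h
    simp only [hPdef]
    rw [← Finset.sum_div, ← h', div_self (hb n).ne']
  have hpsum : ∀ s : Finset ℕ, ∑ k ∈ s, p k ≤ 1 := fun s =>
    sum_irreducibleBridgeCount_div_pow_le_one (d + 2) s
  have hPp : ∀ k, P k - p k =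
      p k * (μ ^ k * (bridgeCount (d + 2) (n - k) : ℝ) / bridgeCount (d + 2) n - 1) := fun k => by
    simp only [hPdef, hpdef]
    have := (hb n).ne'
    have : μ ^ k ≠ 0 := pow_ne_zero k hμ.ne'
    field_simp
  -- head
  have hhead_k : ∀ k ∈ Icc 1 T, |P k - p k| ≤ p k * θ := by
    intro k hk
    have hkT : k ≤ T := (Finset.mem_Icc.1 hk).2
    have hk5 : k ^ 5 ≤ n := le_trans (Nat.pow_le_pow_left hkT 5) hT5
    have hq := hL k hk5
    rw [hPp k, abs_mul, abs_of_nonneg (hp0 k)]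
    refine mul_le_mul_of_nonneg_left (hq.trans ?_) (hp0 k)
    rw [hθdef]
    refine mul_le_mul_of_nonneg_left ?_ hK
    have : (k : ℝ) * r4 ≤ (T : ℝ) * r4 := mul_le_mul_of_nonneg_right (by exact_mod_cast hkT) hr4
    linarith
  have hhead : ∑ k ∈ Icc 1 T, |P k - p k| ≤ θ := by
    calc ∑ k ∈ Icc 1 T, |P k - p k| ≤ ∑ k ∈ Icc 1 T, p k * θ := Finset.sum_le_sum hhead_k
      _ = (∑ k ∈ Icc 1 T, p k) * θ := by rw [Finset.sum_mul]
      _ ≤ 1 * θ := mul_le_mul_of_nonneg_right (hpsum _) hθ0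
      _ = θ := one_mul θ
  refine ⟨hhead, ?_⟩
  -- tail of `P`: `Σ_{T<k≤n} P_k = 1 - Σ_{k≤T} P_k ≤ 1 - Σ_{k≤T} p_k + θ`
  have hPhead : ∑ k ∈ Icc 1 T, p k - θ ≤ ∑ k ∈ Icc 1 T, P k := by
    have : ∑ k ∈ Icc 1 T, (p k - |P k - p k|) ≤ ∑ k ∈ Icc 1 T, P k :=
      Finset.sum_le_sum fun k _ => by
        have := neg_abs_le (P k - p k)
        linarith
    rw [Finset.sum_sub_distrib] at this
    linarith
  have hsP := sum_Icc_split P hTn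
  linarith

/-- **R25a — the first-break-point law of a uniform `n`-bridge vs Kesten's renewal law, with a rate**
(every `d`; modulo a one-step rate `hR16`): `∃ K, ∀ n ≥ 2,
Σ_{k=1}^{n} |λ_k b_{n-k}/b_n - λ_k μ^{-k}| ≤ K/log n`. Here `λ_k b_{n-k}/b_n = P_n(K₁ = k)` is the law of
the first break point of a uniformly random `n`-step bridge (the bijection behind the renewal equation
(4.2.2), `bridgeCount_eq_sum_Icc`) and `λ_k μ^{-k}` is Kesten's renewal law ((4.2.4)); the sum is twice
their total-variation distance. Head `k ≤ n^{1/5}` by the uniform ratio lemma, tail by the explicit Kesten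
tail `kestenTail_le` and `Σ_k P_n(k) = 1`.
[cite: MadrasSlade1993, Theorem 8.3.1 and eq. (4.2.2) (quantitative form, derived)] -/
theorem firstBreakLaw_rate_of_oneStepRate (d : ℕ)
    (hR16 : ∃ K : ℝ, ∀ N : ℕ, 2 ≤ N →
      |(bridgeCount (d + 2) (N + 1) : ℝ) / bridgeCount (d + 2) N - connectiveConstant (d + 2)| ≤
        K / Real.log N) :
    ∃ K : ℝ, ∀ n : ℕ, 2 ≤ n →
      ∑ k ∈ Icc 1 n, |(irreducibleBridgeCount (d + 2) k : ℝ) * (bridgeCount (d + 2) (n - k) : ℝ) /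
            bridgeCount (d + 2) n -
          (irreducibleBridgeCount (d + 2) k : ℝ) * connectiveConstant (d + 2) ^ (-(k : ℤ))| ≤
        K / Real.log n := by
  set μ := connectiveConstant (d + 2) with hμdef
  have hμ : 0 < μ := connectiveConstant_pos (d + 2)
  have hμ1 : 1 ≤ μ := one_le_connectiveConstant (d + 2)
  obtain ⟨K, hK0, N₀, hL⟩ := ratio_uniform_of_oneStepRate d hR16
  -- thresholds
  have hev1 : ∀ᶠ n : ℕ in atTop, max N₀ 2 ≤ n := eventually_ge_atTop _
  have hev2 : ∀ᶠ n : ℕ in atTop, 10 * Real.log (2 * μ) ≤ Real.log n :=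
    (Real.tendsto_log_atTop.comp tendsto_natCast_atTop_atTop).eventually_ge_atTop _
  have hev3 : ∀ᶠ n : ℕ in atTop, 2 * μ ≤ (n : ℝ) ^ ((1 : ℝ) / 5) :=
    ((tendsto_rpow_atTop (by norm_num : (0 : ℝ) < 1 / 5)).comp tendsto_natCast_atTop_atTop).eventually_ge_atTop _
  obtain ⟨N₃, hN₃⟩ := eventually_atTop.1 ((hev1.and hev2).and hev3)
  have hN₃2 : 2 ≤ N₃ := le_trans (le_max_right _ _) ((hN₃ N₃ le_rfl).1).1
  have hlogN₃ : 0 ≤ Real.log N₃ := Real.log_natCast_nonneg N₃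
  refine ⟨42 * K + 40 + 2 * Real.log N₃, fun n hn => ?_⟩
  have hn0 : (0 : ℝ) < n := by exact_mod_cast (show 0 < n by omega)
  have hn1 : 1 ≤ n := by omega
  have hlogn : 0 < Real.log n := Real.log_pos (by exact_mod_cast (show 1 < n by omega))
  have hb : ∀ m, (0 : ℝ) < bridgeCount (d + 2) m := fun m => by
    exact_mod_cast one_le_bridgeCount (d := d + 2) m
  -- the two laws `P` (first break point of a uniform bridge) and `p` (Kesten)
  have hz : ∀ k : ℕ, μ ^ (-(k : ℤ)) = (μ ^ k)⁻¹ := fun k => by rw [zpow_neg, zpow_natCast]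
  simp_rw [hz]
  set P : ℕ → ℝ := fun k =>
    (irreducibleBridgeCount (d + 2) k : ℝ) * (bridgeCount (d + 2) (n - k) : ℝ) / bridgeCount (d + 2) n with hPdef
  set p : ℕ → ℝ := fun k => (irreducibleBridgeCount (d + 2) k : ℝ) * (μ ^ k)⁻¹ with hpdef
  show ∑ k ∈ Icc 1 n, |P k - p k| ≤ _
  have hP0 : ∀ k, 0 ≤ P k := fun k => by
    simp only [hPdef]; exact div_nonneg (by positivity) (hb n).le
  have hp0 : ∀ k, 0 ≤ p k := fun k => by simp only [hpdef]; positivity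
  have hPsum : ∑ k ∈ Icc 1 n, P k = 1 := by
    have h := bridgeCount_eq_sum_Icc (d := d + 2) hn1
    have h' : (bridgeCount (d + 2) n : ℝ) =
        ∑ s ∈ Icc 1 n, (irreducibleBridgeCount (d + 2) s : ℝ) * (bridgeCount (d + 2) (n - s) : ℝ) := by
      exact_mod_cast h
    simp only [hPdef]
    rw [← Finset.sum_div, ← h', div_self (hb n).ne']
  have hpsum : ∀ s : Finset ℕ, ∑ k ∈ s, p k ≤ 1 := fun s => by
    simpa only [hpdef, div_eq_mul_inv] using sum_irreducibleBridgeCount_div_pow_le_one (d + 2) s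
  have hPp : ∀ k, P k - p k =
      p k * (μ ^ k * (bridgeCount (d + 2) (n - k) : ℝ) / bridgeCount (d + 2) n - 1) := fun k => by
    simp only [hPdef, hpdef]
    have := (hb n).ne'
    have : μ ^ k ≠ 0 := pow_ne_zero k hμ.ne'
    field_simp
  have habs_le : ∀ k, |P k - p k| ≤ P k + p k := fun k => by
    rw [abs_le]; constructor <;> linarith [hP0 k, hp0 k]
  by_cases hbig : N₃ ≤ n
  · -- asymptotic regime
    obtain ⟨⟨h1, h2⟩, h3⟩ := hN₃ n hbig
    have hN₀n : N₀ ≤ n := le_trans (le_max_left _ _) h1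
    obtain ⟨hT1, hT5, hTμ, hTy, hTn1, hlogT⟩ := floor_fifth_facts (d := d) hn h3 h2
    set T : ℕ := ⌊(n : ℝ) ^ ((1 : ℝ) / 5)⌋₊ with hTdef
    have hTn : T ≤ n := le_trans (Nat.le_self_pow (by norm_num) T) hT5
    -- the uniform head bound `Θ = K (n^{-1/20} + 1/log n)`
    set r4 : ℝ := (n : ℝ) ^ (-(1 : ℝ) / 4) with hr4def
    set r20 : ℝ := (n : ℝ) ^ (-((1 : ℝ) / 20)) with hr20def
    have hr4 : 0 ≤ r4 := Real.rpow_nonneg hn0.le _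
    have hyr : (n : ℝ) ^ ((1 : ℝ) / 5) * r4 = r20 := by
      rw [hr4def, hr20def, ← Real.rpow_add hn0]; norm_num
    set Θ : ℝ := K * (r20 + 1 / Real.log n) with hΘdef
    have hr20 : 0 ≤ r20 := Real.rpow_nonneg hn0.le _
    have hΘ0 : 0 ≤ Θ := by positivity
    have hhead_k : ∀ k ∈ Icc 1 T, |P k - p k| ≤ p k * Θ := by
      intro k hk
      have hkT : k ≤ T := (Finset.mem_Icc.1 hk).2
      have hk5 : k ^ 5 ≤ n := le_trans (Nat.pow_le_pow_left hkT 5) hT5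
      have hq := hL n hN₀n k hk5
      rw [← hr4def] at hq
      rw [hPp k, abs_mul, abs_of_nonneg (hp0 k)]
      refine mul_le_mul_of_nonneg_left (hq.trans ?_) (hp0 k)
      rw [hΘdef]
      refine mul_le_mul_of_nonneg_left ?_ hK0
      have hkr : (k : ℝ) * r4 ≤ r20 := by
        have : (k : ℝ) ≤ (n : ℝ) ^ ((1 : ℝ) / 5) := le_trans (by exact_mod_cast hkT) hTy
        calc (k : ℝ) * r4 ≤ (n : ℝ) ^ ((1 : ℝ) / 5) * r4 := mul_le_mul_of_nonneg_right this hr4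
          _ = r20 := hyr
      linarith
    have hhead : ∑ k ∈ Icc 1 T, |P k - p k| ≤ Θ := by
      calc ∑ k ∈ Icc 1 T, |P k - p k| ≤ ∑ k ∈ Icc 1 T, p k * Θ := Finset.sum_le_sum hhead_k
        _ = (∑ k ∈ Icc 1 T, p k) * Θ := by rw [Finset.sum_mul]
        _ ≤ 1 * Θ := mul_le_mul_of_nonneg_right (hpsum _) hΘ0
        _ = Θ := one_mul Θ
    -- the dropped Kesten mass `ε = 1 - Σ_{k ≤ T} p_k ≤ 20/log n`
    set ε : ℝ := 1 - ∑ k ∈ Icc 1 T, p k with hεdef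
    have hε : ε ≤ 20 / Real.log n := by
      have hkt := kestenTail_le (d + 2) hT1 hTμ
      have hε' : ε = 1 - ∑ k ∈ Icc 1 T, (irreducibleBridgeCount (d + 2) k : ℝ) / μ ^ k := by
        simp only [hεdef, hpdef, div_eq_mul_inv]
      rw [hε']
      refine hkt.trans ?_
      have hL0 : 0 < Real.log ((T : ℝ) / μ) := lt_of_lt_of_le (by positivity) hlogT
      calc 1 / (1 + Real.log ((T : ℝ) / μ) / 2) ≤ 1 / (Real.log ((T : ℝ) / μ) / 2) :=
            one_div_le_one_div_of_le (by positivity) (by linarith)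
        _ ≤ 1 / (Real.log n / 20) := one_div_le_one_div_of_le (by positivity) (by linarith)
        _ = 20 / Real.log n := by rw [one_div_div]
    -- tail
    have hPhead : ∑ k ∈ Icc 1 T, p k - Θ ≤ ∑ k ∈ Icc 1 T, P k := by
      have : ∑ k ∈ Icc 1 T, (p k - |P k - p k|) ≤ ∑ k ∈ Icc 1 T, P k :=
        Finset.sum_le_sum fun k _ => by
          have := neg_abs_le (P k - p k)
          linarith
      rw [Finset.sum_sub_distrib] at this
      linarith
    have htail : ∑ k ∈ Ico (T + 1) (n + 1), |P k - p k| ≤ 2 * ε + Θ := by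
      have hsP := sum_Icc_split P hTn
      have hsp := sum_Icc_split p hTn
      have hpn := hpsum (Icc 1 n)
      calc ∑ k ∈ Ico (T + 1) (n + 1), |P k - p k|
          ≤ ∑ k ∈ Ico (T + 1) (n + 1), (P k + p k) := Finset.sum_le_sum fun k _ => habs_le k
        _ = ∑ k ∈ Ico (T + 1) (n + 1), P k + ∑ k ∈ Ico (T + 1) (n + 1), p k := Finset.sum_add_distrib
        _ ≤ 2 * ε + Θ := by rw [hεdef]; linarith
    -- total
    have htot : ∑ k ∈ Icc 1 n, |P k - p k| ≤ 2 * Θ + 2 * ε := by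
      rw [sum_Icc_split (fun k => |P k - p k|) hTn]; linarith
    have hΘb : Θ ≤ 21 * K / Real.log n := by
      have h20 : r20 ≤ 20 / Real.log n := rpow_neg_twentieth_le hn
      rw [hΘdef]
      calc K * (r20 + 1 / Real.log n) ≤ K * (20 / Real.log n + 1 / Real.log n) := by gcongr
        _ = 21 * K / Real.log n := by ring
    calc ∑ k ∈ Icc 1 n, |P k - p k| ≤ 2 * Θ + 2 * ε := htot
      _ ≤ 2 * (21 * K / Real.log n) + 2 * (20 / Real.log n) := by linarith
      _ = (42 * K + 40) / Real.log n := by ring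
      _ ≤ (42 * K + 40 + 2 * Real.log N₃) / Real.log n :=
          div_le_div_of_nonneg_right (by linarith) hlogn.le
  · -- small `n`: the sum is at most `2`
    have hnN : n ≤ N₃ := by omega
    have hsum2 : ∑ k ∈ Icc 1 n, |P k - p k| ≤ 2 := by
      calc ∑ k ∈ Icc 1 n, |P k - p k| ≤ ∑ k ∈ Icc 1 n, (P k + p k) := Finset.sum_le_sum fun k _ => habs_le k
        _ = ∑ k ∈ Icc 1 n, P k + ∑ k ∈ Icc 1 n, p k := Finset.sum_add_distrib
        _ ≤ 1 + 1 := by rw [hPsum]; linarith [hpsum (Icc 1 n)]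
        _ = 2 := by norm_num
    have hlogle : Real.log n ≤ Real.log N₃ := Real.log_le_log hn0 (by exact_mod_cast hnN)
    rw [le_div_iff₀ hlogn]
    have := mul_le_mul_of_nonneg_right hsum2 hlogn.le
    linarith [hlogle, hK0]

/-! ### R25c — the mean number of break points of a uniform bridge -/

/-- `B⁺_{T}(1/μ) = Σ_{1 ≤ i ≤ T} b_i μ^{-i}`. [cite: MadrasSlade1993, Definition 3.1.7] -/
private theorem bridgeGFpos_eq_sum_Icc (d T : ℕ) [NeZero d] :
    bridgeGFpos d T (connectiveConstant d)⁻¹ = ∑ i ∈ Icc 1 T, (bridgeCount d i : ℝ) / connectiveConstant d ^ i := by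
  rcases Nat.eq_zero_or_pos T with rfl | hT
  · simp [bridgeGFpos]
  obtain ⟨T', rfl⟩ : ∃ T', T = T' + 1 := ⟨T - 1, by omega⟩
  rw [bridgeGFpos, Finset.sum_range_succ', sum_Icc_one_eq_sum_range'']
  simp only [Nat.succ_ne_zero, if_false, if_true, add_zero]
  refine Finset.sum_congr rfl fun i _ => ?_
  rw [inv_pow, div_eq_mul_inv]

/-- **R25c — the mean number of break points of a uniform `n`-bridge grows at least like `(log n)/10`**
(every `d`; modulo a one-step rate `hR16`): `∃ K, ∀ n ≥ 2, (log n)/10 - K ≤ Σ_{i=1}^{n-1} b_i b_{n-i}/b_n`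
(`b_i b_{n-i}` = number of `n`-step bridges with a break point at `i`; via the uniform ratio lemma on
`i ≤ n^{1/5}` and (3.1.14) `half_log_le_sum_bridgeCount`).
[cite: MadrasSlade1993, Theorem 8.3.1 and eq. (3.1.14) (quantitative form, derived)] -/
theorem mean_breakPoints_ge_of_oneStepRate (d : ℕ)
    (hR16 : ∃ K : ℝ, ∀ N : ℕ, 2 ≤ N →
      |(bridgeCount (d + 2) (N + 1) : ℝ) / bridgeCount (d + 2) N - connectiveConstant (d + 2)| ≤
        K / Real.log N) :
    ∃ K : ℝ, ∀ n : ℕ, 2 ≤ n →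
      Real.log n / 10 - K ≤
        ∑ i ∈ Icc 1 (n - 1), (bridgeCount (d + 2) i : ℝ) * (bridgeCount (d + 2) (n - i) : ℝ) /
          bridgeCount (d + 2) n := by
  set μ := connectiveConstant (d + 2) with hμdef
  have hμ : 0 < μ := connectiveConstant_pos (d + 2)
  have hμ1 : 1 ≤ μ := one_le_connectiveConstant (d + 2)
  obtain ⟨K, hK0, N₀, hL⟩ := ratio_uniform_of_oneStepRate d hR16
  -- thresholds
  have hev1 : ∀ᶠ n : ℕ in atTop, max N₀ 2 ≤ n := eventually_ge_atTop _
  have hev2 : ∀ᶠ n : ℕ in atTop, 10 * Real.log (2 * μ) ≤ Real.log n :=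
    (Real.tendsto_log_atTop.comp tendsto_natCast_atTop_atTop).eventually_ge_atTop _
  have hev3 : ∀ᶠ n : ℕ in atTop, 2 * μ ≤ (n : ℝ) ^ ((1 : ℝ) / 5) :=
    ((tendsto_rpow_atTop (by norm_num : (0 : ℝ) < 1 / 5)).comp tendsto_natCast_atTop_atTop).eventually_ge_atTop _
  have ht0 : Tendsto (fun n : ℕ => (n : ℝ) ^ (-((1 : ℝ) / 20))) atTop (𝓝 0) :=
    (tendsto_rpow_neg_atTop (by norm_num : (0 : ℝ) < 1 / 20)).comp tendsto_natCast_atTop_atTop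
  have hlt : Tendsto (fun n : ℕ => Real.log (n : ℝ)) atTop atTop :=
    Real.tendsto_log_atTop.comp tendsto_natCast_atTop_atTop
  have htl : Tendsto (fun n : ℕ => 1 / Real.log n) atTop (𝓝 0) := by
    refine (hlt.inv_tendsto_atTop).congr fun n => ?_
    simp only [Pi.inv_apply, one_div]
  have hΘt : Tendsto (fun n : ℕ => K * ((n : ℝ) ^ (-((1 : ℝ) / 20)) + 1 / Real.log n)) atTop (𝓝 0) := by
    simpa using (ht0.add htl).const_mul K
  have hev4 : ∀ᶠ n : ℕ in atTop, K * ((n : ℝ) ^ (-((1 : ℝ) / 20)) + 1 / Real.log n) ≤ 1 / 2 :=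
    hΘt.eventually (ge_mem_nhds (by norm_num : (0 : ℝ) < 1 / 2))
  obtain ⟨N₄, hN₄⟩ := eventually_atTop.1 (((hev1.and hev2).and hev3).and hev4)
  have hN₄2 : 2 ≤ N₄ := le_trans (le_max_right _ _) (((hN₄ N₄ le_rfl).1).1).1
  have hlogN₄ : 0 ≤ Real.log N₄ := Real.log_natCast_nonneg N₄
  have hlog2μ : 0 ≤ Real.log (2 * μ) := Real.log_nonneg (by linarith)
  refine ⟨Real.log (2 * μ) / 2 + 21 * K / 10 + Real.log N₄ / 10, fun n hn => ?_⟩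
  have hn0 : (0 : ℝ) < n := by exact_mod_cast (show 0 < n by omega)
  have hn1 : 1 ≤ n := by omega
  have hlogn : 0 < Real.log n := Real.log_pos (by exact_mod_cast (show 1 < n by omega))
  have hb : ∀ m, (0 : ℝ) < bridgeCount (d + 2) m := fun m => by
    exact_mod_cast one_le_bridgeCount (d := d + 2) m
  set f : ℕ → ℝ := fun i =>
    (bridgeCount (d + 2) i : ℝ) * (bridgeCount (d + 2) (n - i) : ℝ) / bridgeCount (d + 2) n with hfdef
  show Real.log n / 10 - _ ≤ ∑ i ∈ Icc 1 (n - 1), f i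
  have hf0 : ∀ i, 0 ≤ f i := fun i => by simp only [hfdef]; exact div_nonneg (by positivity) (hb n).le
  by_cases hbig : N₄ ≤ n
  · obtain ⟨⟨⟨h1, h2⟩, h3⟩, h4⟩ := hN₄ n hbig
    have hN₀n : N₀ ≤ n := le_trans (le_max_left _ _) h1
    obtain ⟨hT1, hT5, hTμ, hTy, hTn1, hlogT⟩ := floor_fifth_facts (d := d) hn h3 h2
    set T : ℕ := ⌊(n : ℝ) ^ ((1 : ℝ) / 5)⌋₊ with hTdef
    have hTn : T ≤ n - 1 := by
      have : (T : ℝ) ≤ ((n - 1 : ℕ) : ℝ) := by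
        rw [Nat.cast_sub hn1]; push_cast; exact hTn1
      exact_mod_cast this
    set r4 : ℝ := (n : ℝ) ^ (-(1 : ℝ) / 4) with hr4def
    set r20 : ℝ := (n : ℝ) ^ (-((1 : ℝ) / 20)) with hr20def
    have hr4 : 0 ≤ r4 := Real.rpow_nonneg hn0.le _
    have hr20 : 0 ≤ r20 := Real.rpow_nonneg hn0.le _
    have hyr : (n : ℝ) ^ ((1 : ℝ) / 5) * r4 = r20 := by
      rw [hr4def, hr20def, ← Real.rpow_add hn0]; norm_num
    set Θ : ℝ := K * (r20 + 1 / Real.log n) with hΘdef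
    have hΘ0 : 0 ≤ Θ := by positivity
    have hΘhalf : Θ ≤ 1 / 2 := h4
    -- termwise lower bound on `i ≤ T`
    have hterm : ∀ i ∈ Icc 1 T, (1 - Θ) * ((bridgeCount (d + 2) i : ℝ) / μ ^ i) ≤ f i := by
      intro i hi
      have hiT : i ≤ T := (Finset.mem_Icc.1 hi).2
      have hi5 : i ^ 5 ≤ n := le_trans (Nat.pow_le_pow_left hiT 5) hT5
      have hq := hL n hN₀n i hi5
      have hq' : 1 - Θ ≤ μ ^ i * (bridgeCount (d + 2) (n - i) : ℝ) / bridgeCount (d + 2) n := by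
        have hkr : (i : ℝ) * r4 ≤ r20 := by
          have : (i : ℝ) ≤ (n : ℝ) ^ ((1 : ℝ) / 5) := le_trans (by exact_mod_cast hiT) hTy
          calc (i : ℝ) * r4 ≤ (n : ℝ) ^ ((1 : ℝ) / 5) * r4 := mul_le_mul_of_nonneg_right this hr4
            _ = r20 := hyr
        have hb2 : K * ((i : ℝ) * r4 + 1 / Real.log n) ≤ Θ := by
          rw [hΘdef]; exact mul_le_mul_of_nonneg_left (by linarith) hK0
        have := (abs_le.1 hq).1
        rw [hr4def] at hb2
        linarith
      have hid : f i = ((bridgeCount (d + 2) i : ℝ) / μ ^ i) *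
          (μ ^ i * (bridgeCount (d + 2) (n - i) : ℝ) / bridgeCount (d + 2) n) := by
        simp only [hfdef]
        have := (hb n).ne'
        have : μ ^ i ≠ 0 := pow_ne_zero i hμ.ne'
        field_simp
      rw [hid, mul_comm]
      exact mul_le_mul_of_nonneg_left hq' (by positivity)
    -- (3.1.14): `½ log(T/μ) ≤ Σ_{i ≤ T} b_i μ^{-i}`
    have h314 : Real.log ((T : ℝ) / μ) / 2 ≤ ∑ i ∈ Icc 1 T, (bridgeCount (d + 2) i : ℝ) / μ ^ i := by
      obtain ⟨T', hT'⟩ : ∃ T', T = T' + 1 := ⟨T - 1, by omega⟩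
      have h := half_log_le_sum_bridgeCount (d := d + 2) T'
      rw [bridgeGFpos_eq_sum_Icc] at h
      have hc : ((T' : ℝ) + 1) = (T : ℝ) := by rw [hT']; push_cast; ring
      rw [hc, ← hT'] at h
      exact h
    have hL₀ : Real.log n / 10 - Real.log (2 * μ) / 2 ≤ Real.log ((T : ℝ) / μ) / 2 := by
      -- from `floor_fifth_facts` we only kept `log n/10 ≤ log(T/μ)`; sharpen via `T ≥ n^{1/5}/2`
      have hT0 : (0 : ℝ) < T := by exact_mod_cast (show 0 < T by omega)
      set y : ℝ := (n : ℝ) ^ ((1 : ℝ) / 5) with hydef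
      have hy0 : 0 < y := by linarith
      have hyT : y < T + 1 := Nat.lt_floor_add_one y
      have hy2 : 2 ≤ y := by linarith
      have hTy2 : y / (2 * μ) ≤ (T : ℝ) / μ := by
        rw [div_le_div_iff₀ (by positivity) hμ]; nlinarith
      have h1' : Real.log (y / (2 * μ)) ≤ Real.log ((T : ℝ) / μ) :=
        Real.log_le_log (by positivity) hTy2
      have h2' : Real.log (y / (2 * μ)) = Real.log y - Real.log (2 * μ) :=
        Real.log_div hy0.ne' (by positivity)
      have h3' : Real.log y = (1 : ℝ) / 5 * Real.log n := by rw [hydef, Real.log_rpow hn0]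
      linarith
    -- assemble
    have hsum_le : ∑ i ∈ Icc 1 T, f i ≤ ∑ i ∈ Icc 1 (n - 1), f i :=
      Finset.sum_le_sum_of_subset_of_nonneg (Finset.Icc_subset_Icc le_rfl hTn) fun i _ _ => hf0 i
    have hmain : (1 - Θ) * (Real.log ((T : ℝ) / μ) / 2) ≤ ∑ i ∈ Icc 1 T, f i := by
      calc (1 - Θ) * (Real.log ((T : ℝ) / μ) / 2)
          ≤ (1 - Θ) * ∑ i ∈ Icc 1 T, (bridgeCount (d + 2) i : ℝ) / μ ^ i :=
            mul_le_mul_of_nonneg_left h314 (by linarith)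
        _ = ∑ i ∈ Icc 1 T, (1 - Θ) * ((bridgeCount (d + 2) i : ℝ) / μ ^ i) := by rw [Finset.mul_sum]
        _ ≤ ∑ i ∈ Icc 1 T, f i := Finset.sum_le_sum hterm
    -- `Θ · log n ≤ 21 K`
    have hΘlog : Θ * Real.log n ≤ 21 * K := by
      have h20 : r20 ≤ 20 / Real.log n := rpow_neg_twentieth_le hn
      have h20' : r20 * Real.log n ≤ 20 := by rwa [le_div_iff₀ hlogn] at h20
      rw [hΘdef]
      have : (r20 + 1 / Real.log n) * Real.log n = r20 * Real.log n + 1 := by field_simp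
      calc K * (r20 + 1 / Real.log n) * Real.log n = K * ((r20 + 1 / Real.log n) * Real.log n) := by ring
        _ = K * (r20 * Real.log n + 1) := by rw [this]
        _ ≤ K * (20 + 1) := by gcongr
        _ = 21 * K := by ring
    have hlogTle : Real.log ((T : ℝ) / μ) / 2 ≤ Real.log n / 10 := by
      have hT0 : (0 : ℝ) < T := by exact_mod_cast (show 0 < T by omega)
      have hy0 : (0 : ℝ) ≤ (n : ℝ) ^ ((1 : ℝ) / 5) := by positivity
      have hTμy : (T : ℝ) / μ ≤ (n : ℝ) ^ ((1 : ℝ) / 5) := by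
        rw [div_le_iff₀ hμ]; nlinarith
      have h1 := Real.log_le_log (by positivity) hTμy
      rw [Real.log_rpow hn0] at h1
      linarith
    have hkey : Real.log n / 10 - Real.log (2 * μ) / 2 - 21 * K / 10 ≤ ∑ i ∈ Icc 1 T, f i := by
      have h1 : Θ * (Real.log ((T : ℝ) / μ) / 2) ≤ Θ * (Real.log n / 10) :=
        mul_le_mul_of_nonneg_left hlogTle hΘ0
      have h2 : Θ * (Real.log n / 10) ≤ 21 * K / 10 := by
        have : Θ * (Real.log n / 10) = Θ * Real.log n / 10 := by ring
        rw [this]; linarith [hΘlog]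
      have h3 : (1 - Θ) * (Real.log ((T : ℝ) / μ) / 2) =
          Real.log ((T : ℝ) / μ) / 2 - Θ * (Real.log ((T : ℝ) / μ) / 2) := by ring
      linarith [hmain, hL₀]
    linarith [hkey, hsum_le, hlogN₄]
  · -- small `n`
    have hnN : n ≤ N₄ := by omega
    have hlogle : Real.log n ≤ Real.log N₄ := Real.log_le_log hn0 (by exact_mod_cast hnN)
    have hS : 0 ≤ ∑ i ∈ Icc 1 (n - 1), f i := Finset.sum_nonneg fun i _ => hf0 i
    linarith [hS, hlogle, hlog2μ, hK0]

/-! ### Unconditional forms (the one-step rate is the tree's `bridgeRatio_rate_log`) -/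

/-- **R25.L, unconditional** (every `d`): `∃ K ≥ 0, ∃ N₀, ∀ n ≥ N₀, ∀ k, k⁵ ≤ n →
|μ^k b_{n-k}/b_n - 1| ≤ K (k n^{-1/4} + 1/log n)` on `ℤ^{d+2}`.
[cite: MadrasSlade1993, Theorem 8.3.1 (proof, eq. (8.3.11); quantitative form, derived)] -/
theorem ratio_uniform (d : ℕ) :
    ∃ K : ℝ, 0 ≤ K ∧ ∃ N₀ : ℕ, ∀ n : ℕ, N₀ ≤ n → ∀ k : ℕ, k ^ 5 ≤ n →
      |connectiveConstant (d + 2) ^ k * (bridgeCount (d + 2) (n - k) : ℝ) / bridgeCount (d + 2) n - 1| ≤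
        K * ((k : ℝ) * (n : ℝ) ^ (-(1 : ℝ) / 4) + 1 / Real.log n) :=
  ratio_uniform_of_oneStepRate d (bridgeRatio_rate_log d)

/-- **R25a, unconditional — Kesten's renewal law is the `K/log n`-limit of the first-break-point law of a
uniform `n`-bridge** (every `d`): `∃ K, ∀ n ≥ 2, Σ_{k=1}^{n} |λ_k b_{n-k}/b_n - λ_k μ^{-k}| ≤ K/log n`.
Printed: Theorem 8.3.1 / Theorem 4.2.2 give the limit with no rate.
[cite: MadrasSlade1993, Theorem 8.3.1 and eq. (4.2.2) (quantitative form, derived)] -/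
theorem firstBreakLaw_rate (d : ℕ) :
    ∃ K : ℝ, ∀ n : ℕ, 2 ≤ n →
      ∑ k ∈ Icc 1 n, |(irreducibleBridgeCount (d + 2) k : ℝ) * (bridgeCount (d + 2) (n - k) : ℝ) /
            bridgeCount (d + 2) n -
          (irreducibleBridgeCount (d + 2) k : ℝ) * connectiveConstant (d + 2) ^ (-(k : ℤ))| ≤
        K / Real.log n :=
  firstBreakLaw_rate_of_oneStepRate d (bridgeRatio_rate_log d)

/-- **R25c, unconditional** (every `d`): `∃ K, ∀ n ≥ 2, (log n)/10 - K ≤ Σ_{i=1}^{n-1} b_i b_{n-i}/b_n` — a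
uniform `n`-step bridge has on average at least `(log n)/10 - K` break points.
[cite: MadrasSlade1993, Theorem 8.3.1 and eq. (3.1.14) (quantitative form, derived)] -/
theorem mean_breakPoints_ge (d : ℕ) :
    ∃ K : ℝ, ∀ n : ℕ, 2 ≤ n →
      Real.log n / 10 - K ≤
        ∑ i ∈ Icc 1 (n - 1), (bridgeCount (d + 2) i : ℝ) * (bridgeCount (d + 2) (n - i) : ℝ) /
          bridgeCount (d + 2) n :=
  mean_breakPoints_ge_of_oneStepRate d (bridgeRatio_rate_log d)

end Literature.Probability.RandomPlanarGeometry.SAW.Zd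

end
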